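/-
Copyright (c) 2026. All rights reserved.
Released under Apache 2.0 license as described in the file LICENSE.
-/
import Summits.CriticalPhenomena.LaceExpansionHighD.NobleBlocksSharp
import Literature.Probability.FitznerVanDerHofstad2017.NobleBoundsNMidSOpen
import Literature.Probability.FitznerVanDerHofstad2017.NobleBoundsNFirstSOpen
import Literature.Probability.FitznerVanDerHofstad2017.NobleBoundsNLowStar
import HarnessLib
import Literature.Probability.FitznerVanDerHofstad2017.NobleBoundsNFirstECut
import Literature.Probability.FitznerVanDerHofstad2017.NobleBoundsNTargetsB
import Literature.Probability.FitznerVanDerHofstad2017.NobleBoundsNLowE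
import Literature.Probability.FitznerVanDerHofstad2017.NobleBoundsNResidualB
import Literature.Probability.FitznerVanDerHofstad2017.NobleBoundsNReal
import Literature.Probability.FitznerVanDerHofstad2017.NobleElementsClosedForms

/-!
# Fitzner–van der Hofstad (2017), Prop. 5.5 (5.34) at `N = M + 2` against the SHARP blocks, hypothesis-free — Part
III §A–§D: the Sharp target families `cellS`/`tgtRegS`/`tgtStarLS`/`tgtJS`/`tgtAllS`, their column bounds against
`blockXSharp`/`blockBSharpFull`, monotonicity, and the re-dispatchers from SHARP slots (twin of
`Literature/…/NobleBoundsNResidualB` §A–§B) (WHAT-IF, DIVERGENCE D77; b2b-lace LEMMAS node N76-X2-D77, module 7/11)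

[FvdH17] = R. Fitzner, R. van der Hofstad, *Mean-field behavior for nearest-neighbor percolation in `d > 10`*,
arXiv:1506.07977v2 (EJP 22 (2017), paper 43).  Page numbers refer to the arXiv version.

SPLIT PROVENANCE: module 7 of 11 of the b2b-lace node N76-X2-D77 (what-if, DIVERGENCE D77) — the 11 modules are the
section-seam split (carver-g217, 2026-08-27) of the single-module form `NobleBoundsNSharpD77.lean` (carver-g51
text-final, sha256 `877e12977f9f9c92`, 2707 lines): every declaration, statement and proof is carried over verbatim and
in the original order; only module boundaries, the repeated `section`/`variable` headers and two docstrings were added.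
PLACEMENT: what-if objects of `NobleBlocksSharp` (b2b-lace LEAN PLACEMENT RULE, REFEREE R491), hence
`namespace Summit.CriticalPhenomena.LaceExpansionHighD.NobleBlocks`.  Conventions: `d`-generic; every declaration
carries its [FvdH17] display / page cite in the docstring; NOTHING is cited as a fact (b2b-lace ABSOLUTE RULE);
additive (no existing declaration is changed). -/

noncomputable section

namespace Summit.CriticalPhenomena.LaceExpansionHighD.NobleBlocks

open Literature.Probability.FitznerVanDerHofstad2017 Literature.Probability.FitznerVanDerHofstad2017.NobleBlocks
open Literature.Probability.FitznerVanDerHofstad2017.NobleBlocks.LenIdx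
open Literature.Probability.LatticeModels Literature.Probability.Percolation
open Literature.Probability.FitznerVanDerHofstad2017.BlockSummation
open Literature.Barriers.CriticalPhenomena
open Literature.Combinatorics.SimpleGraph _root_.SimpleGraph _root_.MeasureTheory
open scoped BigOperators ENNReal Matrix

variable {d : ℕ}

/-! ### §A. The Sharp target families -/

/-- The D77 residue cell of variant `v`: `(false, c) ↦ X_{R′,c}` (the `x = 0` slice `A♯`), `(true, 0) ↦ X_R`
(`δ_{z,t}·T2♯`), else `0`; `Σ_v cellS v = blockXSharp`.
[cite: FitznerVanDerHofstad2017, §5.1 (5.4) (arXiv:1506.07977v2 p. 48) and App. B (pp. 74–76); §4.4 (4.64) (p. 42)] -/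
def cellS (L : Letters d) (κ : Fin d × Bool) (a₀ a' : Fin 3) (u w t z w' u' : Site d) (v : Bool × Fin 3) : ℝ≥0∞ :=
  if v.1 = false then blockXRPrime L v.2 κ a₀ a' u w t z w' u'
  else if v.2 = 0 then blockXR L κ a₀ a' u w t z w' u' else 0

/-- Sharp regular/regular target family: the (β′) print family plus the residue cell.
[cite: FitznerVanDerHofstad2017, §5.1 (5.4) (arXiv:1506.07977v2 p. 48) and App. B (pp. 74–76); §4.4 (4.64) (p. 42)] -/
def tgtRegS (L : Letters d) (κ : Fin d × Bool) (a₀ a' : Fin 3) (u w t z w' u' : Site d) (v : Bool × Fin 3) : ℝ≥0∞ :=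
  tgtRegB L κ a₀ a' u w t z w' u' v + cellS L κ a₀ a' u w t z w' u' v

/-- Sharp `★`/regular target family (lower-`★` junction: `z = w`, class `2` reading).
[cite: FitznerVanDerHofstad2017, §5.1 (5.4) (arXiv:1506.07977v2 p. 48) and App. B (pp. 74–76); §4.4 (4.64) (p. 42)] -/
def tgtStarLS (L : Letters d) (κ : Fin d × Bool) (a' : Fin 3) (u w t z w' u' : Site d) (v : Bool × Fin 3) : ℝ≥0∞ :=
  if z = w then tgtReg L κ 2 a' u w t z w' u' v + cellS L κ 2 a' u w t z w' u' v else 0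

/-- Sharp global target family by class pair (twin of `tgtJB`).
[cite: FitznerVanDerHofstad2017, §5.1 (5.4) (arXiv:1506.07977v2 p. 48) and App. B (pp. 74–76); §4.4 (4.64) (p. 42)] -/
def tgtJS (L : Letters d) (κ : Fin d × Bool) :
    Fin 3 ⊕ Unit → Fin 3 ⊕ Unit → Site d → Site d → Site d → Site d → Site d → Site d → Bool × Fin 3 → ℝ≥0∞
  | Sum.inl a₀, Sum.inl a' => tgtRegS L κ a₀ a'
  | Sum.inl a₀, Sum.inr _ => tgtStarU L κ a₀
  | Sum.inr _, Sum.inl a' => tgtStarLS L κ a'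
  | Sum.inr _, Sum.inr _ => tgtStarLU L κ

/-- [folklore] -/
@[simp] theorem tgtJS_inl_inl (L : Letters d) (κ : Fin d × Bool) (a₀ a' : Fin 3) :
    tgtJS L κ (Sum.inl a₀) (Sum.inl a') = tgtRegS L κ a₀ a' := rfl

/-- [folklore] -/
@[simp] theorem tgtJS_inl_inr (L : Letters d) (κ : Fin d × Bool) (a₀ : Fin 3) (s : Unit) :
    tgtJS L κ (Sum.inl a₀) (Sum.inr s) = tgtStarU L κ a₀ := rfl

/-- [folklore] -/
@[simp] theorem tgtJS_inr_inl (L : Letters d) (κ : Fin d × Bool) (s : Unit) (a' : Fin 3) :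
    tgtJS L κ (Sum.inr s) (Sum.inl a') = tgtStarLS L κ a' := rfl

/-- [folklore] -/
@[simp] theorem tgtJS_inr_inr (L : Letters d) (κ : Fin d × Bool) (s s' : Unit) :
    tgtJS L κ (Sum.inr s) (Sum.inr s') = tgtStarLU L κ := rfl

/-! ### §B. Column bounds against the Sharp pointwise block `blockBFullptB' L (blockXSharp L)` -/

/-- The cells sum EXACTLY into the payload `X♯`.
[cite: FitznerVanDerHofstad2017, §5.1 (5.4) (arXiv:1506.07977v2 p. 48) and App. B (pp. 74–76); §4.4 (4.64) (p. 42)] -/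
theorem sum_cellS_eq_blockXSharp (L : Letters d) (κ : Fin d × Bool) (a₀ a' : Fin 3) (u w t z w' u' : Site d) :
    ∑ v, cellS L κ a₀ a' u w t z w' u' v = blockXSharp L κ a₀ a' u w t z w' u' := by
  rw [Fintype.sum_prod_type, Fintype.sum_bool]
  simp [cellS, blockXSharp, Fin.sum_univ_three, add_comm]

/-- Over any sub-family of variants the cells are bounded by the payload.
[cite: FitznerVanDerHofstad2017, §5.1 (5.4) (arXiv:1506.07977v2 p. 48) and App. B (pp. 74–76); §4.4 (4.64) (p. 42)] -/
theorem sum_filter_cellS_le_blockXSharp (L : Letters d) (κ : Fin d × Bool) (a₀ a' : Fin 3)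
    (u w t z w' u' : Site d) (P : Bool × Fin 3 → Prop) [DecidablePred P] :
    ∑ v ∈ Finset.univ.filter P, cellS L κ a₀ a' u w t z w' u' v ≤ blockXSharp L κ a₀ a' u w t z w' u' :=
  (Finset.sum_le_sum_of_subset (Finset.filter_subset _ _)).trans (sum_cellS_eq_blockXSharp L κ a₀ a' u w t z w' u').le

/-- Column bound of the Sharp regular family against the Sharp pointwise (β′) block
(`blockBFullptB' L X♯ = blockBFullptB' L 0 + X♯`).
[cite: FitznerVanDerHofstad2017, §5.1 (5.4) (arXiv:1506.07977v2 p. 48) and App. B (pp. 74–76); §4.4 (4.64) (p. 42)] -/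
theorem sum_filter_tgtRegS_le (L : Letters d) (κ : Fin d × Bool) (a₀ a' : Fin 3)
    (u w t z w' u' : Site d) (P : Bool × Fin 3 → Prop) [DecidablePred P] :
    ∑ v ∈ Finset.univ.filter P, tgtRegS L κ a₀ a' u w t z w' u' v ≤
      blockBFullptB' L (blockXSharp L) κ a₀ a' u w t z w' u' := by
  have h₁ := sum_filter_tgtRegB_le_blockBFullptB' L κ a₀ a' u w t z w' u' (0 : DirBlockFamilyPt d) P
  have h₂ := sum_filter_cellS_le_blockXSharp L κ a₀ a' u w t z w' u' P
  unfold blockBFullptB' at h₁ ⊢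
  rw [blockBpt'_eq_add_X L (blockBNTptB' L) (blockXSharp L)]
  simp only [tgtRegS, Finset.sum_add_distrib]
  exact add_le_add h₁ h₂

/-- Column bound of the Sharp lower-`★` family: `Σ_v tgtStarLS ≤ 𝟙{z = w}·B'_pt[X♯]^{κ,2,a′}`.
[cite: FitznerVanDerHofstad2017, §5.1 (5.4) (arXiv:1506.07977v2 p. 48) and App. B (pp. 74–76); §4.4 (4.64) (p. 42)] -/
theorem sum_tgtStarLS_le (L : Letters d) (κ : Fin d × Bool) (a' : Fin 3) (u w t z w' u' : Site d) :
    ∑ v, tgtStarLS L κ a' u w t z w' u' v ≤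
      if z = w then blockBFullpt' L (blockXSharp L) κ 2 a' u w t z w' u' else 0 := by
  by_cases h : z = w
  · simp only [tgtStarLS, if_pos h]
    have h₁ := sum_tgtReg_le_blockBFullpt' L κ 2 a' u w t z w' u' (0 : DirBlockFamilyPt d)
    have h₂ := (sum_cellS_eq_blockXSharp L κ 2 a' u w t z w' u').le
    unfold blockBFullpt' at h₁ ⊢
    rw [blockBpt'_eq_add_X L (blockBNTpt' L) (blockXSharp L), Finset.sum_add_distrib]
    exact add_le_add h₁ h₂
  · simp [tgtStarLS, if_neg h]

/-- The same over any sub-family of variants.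
[cite: FitznerVanDerHofstad2017, §5.1 (5.4) (arXiv:1506.07977v2 p. 48) and App. B (pp. 74–76); §4.4 (4.64) (p. 42)] -/
theorem sum_filter_tgtStarLS_le (L : Letters d) (κ : Fin d × Bool) (a' : Fin 3) (u w t z w' u' : Site d)
    (P : Bool × Fin 3 → Prop) [DecidablePred P] :
    ∑ v ∈ Finset.univ.filter P, tgtStarLS L κ a' u w t z w' u' v ≤
      if z = w then blockBFullpt' L (blockXSharp L) κ 2 a' u w t z w' u' else 0 :=
  (Finset.sum_le_sum_of_subset (Finset.filter_subset _ _)).trans (sum_tgtStarLS_le L κ a' u w t z w' u')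

/-- Column bound of the Sharp global family — the twin of `sum_filter_tgtJB_le` at `X := blockXSharp L`.
[cite: FitznerVanDerHofstad2017, §5.1 (5.4) (arXiv:1506.07977v2 p. 48) and App. B (pp. 74–76); §4.4 (4.64) (p. 42)] -/
theorem sum_filter_tgtJS_le (L : Letters d) (κ : Fin d × Bool) (P : Bool × Fin 3 → Prop) [DecidablePred P] :
    ∀ (α β : Fin 3 ⊕ Unit) (u w t z w' u' : Site d),
      ∑ v ∈ Finset.univ.filter P, tgtJS L κ α β u w t z w' u' v ≤
        secStarBpt (blockBFullptB' L (blockXSharp L)) 2 0 κ α β u w t z w' u'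
  | Sum.inl a₀, Sum.inl a', u, w, t, z, w', u' => by
      rw [tgtJS_inl_inl, secStarBpt, starBpt_inl_inl]
      exact sum_filter_tgtRegS_le L κ a₀ a' u w t z w' u' P
  | Sum.inl a₀, Sum.inr s, u, w, t, z, w', u' => by
      rw [tgtJS_inl_inr, secStarBpt_blockBFullptB', starBpt_inl_inr]
      exact sum_filter_tgtStarU_le L κ a₀ u w t z w' u' (blockXSharp L) P
  | Sum.inr s, Sum.inl a', u, w, t, z, w', u' => by
      rw [tgtJS_inr_inl, secStarBpt_blockBFullptB', starBpt_inr_inl]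
      exact sum_filter_tgtStarLS_le L κ a' u w t z w' u' P
  | Sum.inr s, Sum.inr s', u, w, t, z, w', u' => by
      rw [tgtJS_inr_inr, secStarBpt_blockBFullptB', starBpt_inr_inr]
      exact sum_filter_tgtStarLU_le L κ u w t z w' u' (blockXSharp L) P

/-! ### §C. The per-junction Sharp targets and the consumer's `hT` (twin of `tgtAllB` / `sum_filter_tgtAllB_le`) -/

section TargetsS

variable (L : Letters d) (M : ℕ) (x : Site d) (a : Fin (M + 2) → Fin 3 ⊕ Unit) (c : Fin 3 ⊕ Unit)
  (b : Fin (M + 2) → Site d × Site d) (w t z : Fin (M + 2) → Site d) (κ : Fin (M + 2) → Fin d × Bool)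

/-- The Sharp target family of the first/middle junction `i` under direction vector `κ`.
[cite: FitznerVanDerHofstad2017, §5.1 (5.4) (arXiv:1506.07977v2 p. 48) and App. B (pp. 74–76); §4.4 (4.64) (p. 42)] -/
def tgtAllS (i : Fin (M + 1)) (v : Bool × Fin 3) : ℝ≥0∞ :=
  (if i = 0 then starS (blockPS L) (a (0 : Fin (M + 1)).castSucc) (b (0 : Fin (M + 1)).castSucc).1
      (w (0 : Fin (M + 1)).castSucc) else 1) *
    tgtJS L (κ i.castSucc) (a i.castSucc) (a i.succ) (b i.castSucc).1 (w i.castSucc) (t i.castSucc) (z i.castSucc)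
      (w i.succ) (b i.succ).1 v

/-- `hT`, Sharp variant, for `S := starS (blockPS L)` and `Bpt := secStarBpt (blockBFullptB' L (blockXSharp L)) 2 0`.
[cite: FitznerVanDerHofstad2017, §5.1 (5.4) (arXiv:1506.07977v2 p. 48) and App. B (pp. 74–76); §4.4 (4.64) (p. 42)] -/
theorem sum_filter_tgtAllS_le (i : Fin (M + 1)) :
    ∑ v ∈ Finset.univ.filter (AdmV M a i), tgtAllS L M a b w t z κ i v ≤
      (if i = 0 then starS (blockPS L) (a 0) (b 0).1 (w 0) else 1) *
        secStarBpt (blockBFullptB' L (blockXSharp L)) 2 0 (κ i.castSucc) (a i.castSucc) (a i.succ) (b i.castSucc).1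
          (w i.castSucc) (t i.castSucc) (z i.castSucc) (w i.succ) (b i.succ).1 := by
  unfold tgtAllS
  rw [← Finset.mul_sum]
  exact mul_le_mul' le_rfl (sum_filter_tgtJS_le L (κ i.castSucc) (AdmV M a i) _ _ _ _ _ _ _ _)

end TargetsS

/-! ### §D. Monotonicity of the Sharp targets; the re-dispatchers from SHARP slots -/

/-- `tgtRegB ≤ tgtRegS` pointwise. [cite: FitznerVanDerHofstad2017, §5.1 (5.4) (arXiv:1506.07977v2 p. 48)] -/
theorem tgtRegB_le_tgtRegS (L : Letters d) (κ : Fin d × Bool) (a₀ a' : Fin 3) (u w t z w' u' : Site d)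
    (v : Bool × Fin 3) : tgtRegB L κ a₀ a' u w t z w' u' v ≤ tgtRegS L κ a₀ a' u w t z w' u' v :=
  le_self_add

/-- `tgtStarL ≤ tgtStarLS` pointwise. [cite: FitznerVanDerHofstad2017, §5.1 (5.4) (arXiv:1506.07977v2 p. 48)] -/
theorem tgtStarL_le_tgtStarLS (L : Letters d) (κ : Fin d × Bool) (a' : Fin 3) (u w t z w' u' : Site d)
    (v : Bool × Fin 3) : tgtStarL L κ a' u w t z w' u' v ≤ tgtStarLS L κ a' u w t z w' u' v := by
  by_cases h : z = w
  · rw [tgtStarL_of_eq L κ a' u w t z w' u' h, tgtStarLS, if_pos h]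
    exact le_self_add
  · rw [tgtStarL_of_ne L κ a' u w t z w' u' h]
    exact zero_le

section DispatchS

variable (p : unitInterval) (M : ℕ) (x : Site d) (b : Fin (M + 2) → Site d × Site d) (w t z : Fin (M + 2) → Site d)
  (a : Fin (M + 2) → Fin 3 ⊕ Unit) (c : Fin 3 ⊕ Unit) (τ : Fin (M + 1) → Bool × Fin 3)

/-- **`pkg` at a MIDDLE junction with regular class pair, SHARP target, from the two SHARP slots**: on the corner
`w_{k+1} = t_k` (R′) resp. the cut-through `z_k = t_k ∼ w_{k+1}` (R) the slot package is used as given; off both cells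
the landed (β′) dispatcher `nonempty_jPkg_mid_regB` (its slots discharged by contradiction), made monotone in the
target (`tgtRegB ≤ tgtRegS`).
[cite: FitznerVanDerHofstad2017, §6.1 (6.4) "Case a = 0 / 1 / ≥ 2" × "Case b = 0 / 1 / ≥ 2" and the coincidence cases `w' = t`, `z = t` (arXiv:1506.07977v2 pp. 58–59); §5.1 (5.4) (p. 48); §4.4 (4.64) (p. 42)] -/
theorem nonempty_jPkg_mid_regS (i i₀ : Fin (M + 1)) (hk : i₀.succ = i.castSucc) (κ : Fin d × Bool)
    (hb : (b i.castSucc).2 = (b i.castSucc).1 + stepVec κ) (a₀ a' : Fin 3)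
    (ha : a i.castSucc = Sum.inl a₀) (ha' : a i.succ = Sum.inl a')
    (hR' : (τ i).1 = false → a' ≠ 0 → w i.succ = t i.castSucc →
      Nonempty (JPkg p (jctx M x b w t z a τ i.castSucc) (JFacts M x b w t z a c τ)
        (tgtRegS (Letters.perc d p) κ a₀ a' (b i.castSucc).1 (w i.castSucc) (t i.castSucc) (z i.castSucc) (w i.succ)
          (b i.succ).1 (τ i))))
    (hR : τ i = (true, 0) → a' = 2 → t i.castSucc ≠ (b i.succ).1 → z i.castSucc = t i.castSucc →
      (zdGraph d).Adj (w i.succ) (t i.castSucc) →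
      Nonempty (JPkg p (jctx M x b w t z a τ i.castSucc) (JFacts M x b w t z a c τ)
        (tgtRegS (Letters.perc d p) κ a₀ a' (b i.castSucc).1 (w i.castSucc) (t i.castSucc) (z i.castSucc) (w i.succ)
          (b i.succ).1 (τ i)))) :
    Nonempty (JPkg p (jctx M x b w t z a τ i.castSucc) (JFacts M x b w t z a c τ)
      (tgtRegS (Letters.perc d p) κ a₀ a' (b i.castSucc).1 (w i.castSucc) (t i.castSucc) (z i.castSucc) (w i.succ)
        (b i.succ).1 (τ i))) := by
  by_cases h₁ : (τ i).1 = false ∧ a' ≠ 0 ∧ w i.succ = t i.castSucc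
  · exact hR' h₁.1 h₁.2.1 h₁.2.2
  by_cases h₂ : τ i = (true, 0) ∧ a' = 2 ∧ t i.castSucc ≠ (b i.succ).1 ∧ z i.castSucc = t i.castSucc ∧
      (zdGraph d).Adj (w i.succ) (t i.castSucc)
  · exact hR h₂.1 h₂.2.1 h₂.2.2.1 h₂.2.2.2.1 h₂.2.2.2.2
  obtain ⟨P⟩ := nonempty_jPkg_mid_regB p M x b w t z a c τ i i₀ hk κ hb a₀ a' ha ha'
    (fun h1 h2 h3 => (h₁ ⟨h1, h2, h3⟩).elim) (fun h1 h2 h3 h4 h5 => (h₂ ⟨h1, h2, h3, h4, h5⟩).elim)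
  exact ⟨P.monoTgt (tgtRegB_le_tgtRegS _ _ _ _ _ _ _ _ _ _ _)⟩

/-- **`pkg` at the FIRST junction with regular class pair, SHARP target, from the two SHARP slots** (behind the start
letter `P^{S,a₀}(u_0, w_0)`); off the cells: `nonempty_jPkg_first_regB`, monotone in the target.
[cite: FitznerVanDerHofstad2017, §6.1 (6.4)–(6.10) (arXiv:1506.07977v2 pp. 58–59); §5.1 (5.4) (p. 48); §4.4 (4.64) (p. 42)] -/
theorem nonempty_jPkg_first_regS (κ : Fin d × Bool)
    (hb : (b (0 : Fin (M + 1)).castSucc).2 = (b (0 : Fin (M + 1)).castSucc).1 + stepVec κ) (a₀ a' : Fin 3)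
    (ha : a (0 : Fin (M + 1)).castSucc = Sum.inl a₀) (ha' : a (0 : Fin (M + 1)).succ = Sum.inl a')
    (hR' : (τ 0).1 = false → a' ≠ 0 → w (0 : Fin (M + 1)).succ = t (0 : Fin (M + 1)).castSucc →
      Nonempty (JPkg p (jctx M x b w t z a τ (0 : Fin (M + 1)).castSucc) (JFacts M x b w t z a c τ)
        (blockPS (Letters.perc d p) a₀ (b (0 : Fin (M + 1)).castSucc).1 (w (0 : Fin (M + 1)).castSucc) *
          tgtRegS (Letters.perc d p) κ a₀ a' (b (0 : Fin (M + 1)).castSucc).1 (w (0 : Fin (M + 1)).castSucc)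
            (t (0 : Fin (M + 1)).castSucc) (z (0 : Fin (M + 1)).castSucc) (w (0 : Fin (M + 1)).succ)
            (b (0 : Fin (M + 1)).succ).1 (τ 0))))
    (hR : τ 0 = (true, 0) → a' = 2 → t (0 : Fin (M + 1)).castSucc ≠ (b (0 : Fin (M + 1)).succ).1 →
      z (0 : Fin (M + 1)).castSucc = t (0 : Fin (M + 1)).castSucc →
      (zdGraph d).Adj (w (0 : Fin (M + 1)).succ) (t (0 : Fin (M + 1)).castSucc) →
      Nonempty (JPkg p (jctx M x b w t z a τ (0 : Fin (M + 1)).castSucc) (JFacts M x b w t z a c τ)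
        (blockPS (Letters.perc d p) a₀ (b (0 : Fin (M + 1)).castSucc).1 (w (0 : Fin (M + 1)).castSucc) *
          tgtRegS (Letters.perc d p) κ a₀ a' (b (0 : Fin (M + 1)).castSucc).1 (w (0 : Fin (M + 1)).castSucc)
            (t (0 : Fin (M + 1)).castSucc) (z (0 : Fin (M + 1)).castSucc) (w (0 : Fin (M + 1)).succ)
            (b (0 : Fin (M + 1)).succ).1 (τ 0)))) :
    Nonempty (JPkg p (jctx M x b w t z a τ (0 : Fin (M + 1)).castSucc) (JFacts M x b w t z a c τ)
      (blockPS (Letters.perc d p) a₀ (b (0 : Fin (M + 1)).castSucc).1 (w (0 : Fin (M + 1)).castSucc) *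
        tgtRegS (Letters.perc d p) κ a₀ a' (b (0 : Fin (M + 1)).castSucc).1 (w (0 : Fin (M + 1)).castSucc)
          (t (0 : Fin (M + 1)).castSucc) (z (0 : Fin (M + 1)).castSucc) (w (0 : Fin (M + 1)).succ)
          (b (0 : Fin (M + 1)).succ).1 (τ 0))) := by
  by_cases h₁ : (τ 0).1 = false ∧ a' ≠ 0 ∧ w (0 : Fin (M + 1)).succ = t (0 : Fin (M + 1)).castSucc
  · exact hR' h₁.1 h₁.2.1 h₁.2.2
  by_cases h₂ : τ 0 = (true, 0) ∧ a' = 2 ∧ t (0 : Fin (M + 1)).castSucc ≠ (b (0 : Fin (M + 1)).succ).1 ∧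
      z (0 : Fin (M + 1)).castSucc = t (0 : Fin (M + 1)).castSucc ∧
      (zdGraph d).Adj (w (0 : Fin (M + 1)).succ) (t (0 : Fin (M + 1)).castSucc)
  · exact hR h₂.1 h₂.2.1 h₂.2.2.1 h₂.2.2.2.1 h₂.2.2.2.2
  obtain ⟨P⟩ := nonempty_jPkg_first_regB p M x b w t z a c τ κ hb a₀ a' ha ha'
    (fun h1 h2 h3 => (h₁ ⟨h1, h2, h3⟩).elim) (fun h1 h2 h3 h4 h5 => (h₂ ⟨h1, h2, h3, h4, h5⟩).elim)
  exact ⟨P.monoTgt (mul_le_mul' le_rfl (tgtRegB_le_tgtRegS _ _ _ _ _ _ _ _ _ _ _))⟩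

/-- **`pkg` at a MIDDLE lower-`★` junction, SHARP target, from the two SHARP slots**: off the cells the landed
`NobleBoundsNLowE.nonempty_jPkg_mid_starL'`, monotone in the target (`tgtStarL ≤ tgtStarLS`).
[cite: FitznerVanDerHofstad2017, §6.1 (6.4) "Case a" × "Case b" (arXiv:1506.07977v2 pp. 58–59); §5.1 (5.4) (p. 48) and "Elements of the bounds" (p. 49); §4.4 (4.64) (p. 42)] -/
theorem nonempty_jPkg_mid_starLS (i i₀ : Fin (M + 1)) (hk : i₀.succ = i.castSucc) (κ : Fin d × Bool)
    (hb : (b i.castSucc).2 = (b i.castSucc).1 + stepVec κ) {u₀ : Unit} (ha : a i.castSucc = Sum.inr u₀)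
    (a' : Fin 3) (ha' : a i.succ = Sum.inl a')
    (hR' : (τ i).1 = false → a' ≠ 0 → w i.succ = t i.castSucc →
      Nonempty (JPkg p (jctx M x b w t z a τ i.castSucc) (JFacts M x b w t z a c τ)
        (tgtStarLS (Letters.perc d p) κ a' (b i.castSucc).1 (w i.castSucc) (t i.castSucc) (z i.castSucc) (w i.succ)
          (b i.succ).1 (τ i))))
    (hRS : (τ i).1 = true → (τ i).2 = 0 → a' = 2 → t i.castSucc ≠ (b i.succ).1 →
      z i.castSucc = t i.castSucc → z i.castSucc = w i.castSucc → (zdGraph d).Adj (w i.succ) (t i.castSucc) →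
      Nonempty (JPkg p (jctx M x b w t z a τ i.castSucc) (JFacts M x b w t z a c τ)
        (tgtStarLS (Letters.perc d p) κ a' (b i.castSucc).1 (w i.castSucc) (t i.castSucc) (z i.castSucc) (w i.succ)
          (b i.succ).1 (τ i)))) :
    Nonempty (JPkg p (jctx M x b w t z a τ i.castSucc) (JFacts M x b w t z a c τ)
      (tgtStarLS (Letters.perc d p) κ a' (b i.castSucc).1 (w i.castSucc) (t i.castSucc) (z i.castSucc) (w i.succ)
        (b i.succ).1 (τ i))) := by
  by_cases h₁ : (τ i).1 = false ∧ a' ≠ 0 ∧ w i.succ = t i.castSucc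
  · exact hR' h₁.1 h₁.2.1 h₁.2.2
  by_cases h₂ : (τ i).1 = true ∧ (τ i).2 = 0 ∧ a' = 2 ∧ t i.castSucc ≠ (b i.succ).1 ∧
      z i.castSucc = t i.castSucc ∧ z i.castSucc = w i.castSucc ∧ (zdGraph d).Adj (w i.succ) (t i.castSucc)
  · exact hRS h₂.1 h₂.2.1 h₂.2.2.1 h₂.2.2.2.1 h₂.2.2.2.2.1 h₂.2.2.2.2.2.1 h₂.2.2.2.2.2.2
  obtain ⟨P⟩ := nonempty_jPkg_mid_starL' p M x b w t z a c τ i i₀ hk κ hb ha a' ha'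
    (fun h1 h2 h3 => (h₁ ⟨h1, h2, h3⟩).elim)
    (fun h1 h2 h3 h4 h5 h6 h7 => (h₂ ⟨h1, h2, h3, h4, h5, h6, h7⟩).elim)
  exact ⟨P.monoTgt (tgtStarL_le_tgtStarLS _ _ _ _ _ _ _ _ _ _)⟩


end DispatchS

end Summit.CriticalPhenomena.LaceExpansionHighD.NobleBlocks

end
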